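import Mathlib.Analysis.InnerProductSpace.PiL2
import Mathlib.Analysis.InnerProductSpace.Adjoint
import HarnessLib

/-!
# Euclidean models: a positive definite symmetric form is the standard inner product in suitable linear coordinates;
# the operator of a bilinear form; Gram operators `T†T` identified through their forms

Topic `Literature/Analysis/InnerProduct`; companion of `OrthogonalSumJacobian.lean` (the Faddeev–Popov ∕ Gram Jacobian
`√det(T†T)`) and of the Laplace-method files of `Literature/Analysis/Asymptotics` (`tendsto_laplaceMethod_orbit`, …,
all stated for an abstract finite-dimensional real INNER PRODUCT space `V` with its Lebesgue measure `volume`).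
Everything here is PROVED; no definitions, no named facts, no instances.

WHY.  Consumers meet concrete parameter spaces that are finite-dimensional real vector spaces carrying a NATURAL positive
definite symmetric bilinear form `b` (an `L²`-type pairing: e.g. a space of Lie-algebra-valued lattice fields with
`Σ_x Re tr(a(x)ᴴ a'(x))`, or a linear subspace of such — a gauge slice) but whose ambient Lean type already carries a
DIFFERENT norm (a `Π`-type sup norm), so that no `InnerProductSpace ℝ` instance compatible with `b` can be registered on
it.  The way out that needs no type synonyms and no instances: linear coordinates `e : W ≃ₗ[ℝ] ℝ^m`
(`ℝ^m = EuclideanSpace ℝ (Fin m)`, `m = dim W`) in which `b` IS the standard inner product,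
`⟪e v, e w⟫ = b(v, w)` — i.e. a `b`-orthonormal basis (Gram–Schmidt; «a Hermitian matrix is positive definite iff it is
*congruent to the identity»).  All inner-product-space statements are then instantiated on `ℝ^m` (which has its Borel
structure and Lebesgue measure) and transported through `e`.

RESULTS (namespace `Literature.Analysis.InnerProduct`).
* §1 ★ `exists_linearEquiv_euclideanSpace_inner_eq` — `W` a finite-dimensional real vector space (only `AddCommGroup`,
  `Module ℝ`, `FiniteDimensional` are assumed — whatever norm the type may otherwise carry is irrelevant), `b` bilinear,
  symmetric, `b(v, v) > 0` for `v ≠ 0` ⇒ `∃ e : W ≃ₗ[ℝ] EuclideanSpace ℝ (Fin (finrank ℝ W)), ∀ v w, ⟪e v, e w⟫ = b v w`;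
  `exists_linearEquiv_euclideanSpace_norm_sq_eq` adds `‖e v‖² = b(v, v)`.
* §2 ★ `exists_isSymmetric_inner_eq` — on a finite-dimensional real inner product space every symmetric bilinear form
  `B` is `⟪A u, v⟫` for a unique-up-to-extensionality symmetric operator `A` (Riesz); with
  `inner_pos_of_form_pos` ∕ the coercivity transfer `exists_isSymmetric_inner_eq_of_coercive`
  (`c·‖u‖² ≤ B(u, u)` ⇒ `c‖u‖² ≤ ⟪A u, u⟫`) — the operator `A` the Laplace-method theorems want, from a Hessian FORM.
* §3 `adjoint_comp_self_eq_of_inner` — if `⟪T x, T y⟫ = ⟪G x, y⟫` for all `x, y` then `T† ∘ T = G`; with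
  `det_adjoint_comp_self_eq_det_of_inner_conj` (`⟪T x, T y⟫ = ⟪e (Δ (e⁻¹ x)), y⟫` ⇒ `det(T†T) = det Δ`): the
  Faddeev–Popov determinant `det(T†T)` of `OrthogonalSumJacobian.lean` IS the determinant of the consumer's own Gram ∕
  Laplace-type operator `Δ` read in the Euclidean coordinates of §1.

## References
[cite: HornJohnson2013, Cor. 7.2.8 (a Hermitian matrix is positive definite iff it is *congruent to the identity),
 Thm 7.2.7, and §0.6.4–0.6.5 (Gram–Schmidt orthonormalisation; orthonormal bases of an inner product space);
 Thm 7.2.10 (Gram matrices)]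
[cite: ReedSimon1972, vol. I §II.2, Thm II.4 (the Riesz lemma) and its Corollary (a bounded sesquilinear form is
 `B(x, y) = (Ax, y)` for a unique bounded operator `A`)]
-/

open _root_.Module

open scoped _root_.InnerProductSpace _root_.BigOperators

namespace Literature.Analysis.InnerProduct

/-! ## §1 Euclidean coordinates for a positive definite symmetric bilinear form -/

section Model

variable {W : Type*} [AddCommGroup W] [Module ℝ W] [FiniteDimensional ℝ W]

/-- ★ **A positive definite symmetric bilinear form is the Euclidean inner product in suitable linear coordinates.**
`W` a finite-dimensional real vector space, `b : W →ₗ W →ₗ ℝ` symmetric with `b(v, v) > 0` for `v ≠ 0`.  Then there is a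
linear isomorphism `e : W ≃ₗ[ℝ] EuclideanSpace ℝ (Fin (finrank ℝ W))` with `⟪e v, e w⟫ = b(v, w)` for all `v, w` (the
coordinates in a `b`-orthonormal basis).  Only the linear structure of `W` enters: the statement is insensitive to any
norm the type `W` may already carry.
[cite: HornJohnson2013, Cor. 7.2.8 (positive definite ⇔ *congruent to the identity) with §0.6.4–0.6.5 (Gram–Schmidt)] -/
theorem exists_linearEquiv_euclideanSpace_inner_eq (b : W →ₗ[ℝ] W →ₗ[ℝ] ℝ) (hsymm : ∀ v w, b v w = b w v)
    (hpos : ∀ v, v ≠ 0 → 0 < b v v) :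
    ∃ e : W ≃ₗ[ℝ] EuclideanSpace ℝ (Fin (finrank ℝ W)), ∀ v w, ⟪e v, e w⟫_ℝ = b v w := by
  classical
  have hnn : ∀ v, 0 ≤ b v v := fun v => by
    by_cases hv : v = 0
    · simp only [hv, map_zero, le_refl]
    · exact (hpos v hv).le
  let cr : InnerProductSpace.Core ℝ W :=
    { inner := fun v w => b v w
      conj_inner_symm := fun v w => by simp only [conj_trivial]; exact hsymm w v
      re_inner_nonneg := fun v => by simp only [RCLike.re_to_real]; exact hnn v
      add_left := fun u v w => by simp only [map_add, LinearMap.add_apply]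
      smul_left := fun u v r => by simp only [map_smul, LinearMap.smul_apply, smul_eq_mul, conj_trivial]
      definite := fun v hv => by
        by_contra h
        exact (hpos v h).ne' hv }
  letI : NormedAddCommGroup W := cr.toNormedAddCommGroup
  letI : InnerProductSpace ℝ W := InnerProductSpace.ofCore cr.toCore
  refine ⟨(stdOrthonormalBasis ℝ W).repr.toLinearEquiv, fun v w => ?_⟩
  simp only [LinearIsometryEquiv.coe_toLinearEquiv, LinearIsometryEquiv.inner_map_map]
  rfl

/-- The same coordinates read as a norm identity: `‖e v‖² = b(v, v)` (and `⟪e v, e w⟫ = b(v, w)`).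
[cite: HornJohnson2013, Cor. 7.2.8 with §0.6.4–0.6.5] -/
theorem exists_linearEquiv_euclideanSpace_norm_sq_eq (b : W →ₗ[ℝ] W →ₗ[ℝ] ℝ) (hsymm : ∀ v w, b v w = b w v)
    (hpos : ∀ v, v ≠ 0 → 0 < b v v) :
    ∃ e : W ≃ₗ[ℝ] EuclideanSpace ℝ (Fin (finrank ℝ W)),
      (∀ v w, ⟪e v, e w⟫_ℝ = b v w) ∧ ∀ v, ‖e v‖ ^ 2 = b v v := by
  obtain ⟨e, he⟩ := exists_linearEquiv_euclideanSpace_inner_eq b hsymm hpos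
  exact ⟨e, he, fun v => by rw [← real_inner_self_eq_norm_sq, he]⟩

end Model

/-! ## §2 The symmetric operator of a symmetric bilinear form (Riesz) -/

section Operator

variable {E : Type*} [NormedAddCommGroup E] [InnerProductSpace ℝ E] [FiniteDimensional ℝ E]

/-- ★ **The operator of a bilinear form.**  On a finite-dimensional real inner product space every symmetric bilinear
form `B` is represented, `B(u, v) = ⟪A u, v⟫`, by a symmetric linear operator `A` (explicitly
`A u = Σ_i B(u, bᵢ) bᵢ` in an orthonormal basis `(bᵢ)`).
[cite: ReedSimon1972, vol. I §II.2 Thm II.4 (Riesz lemma) and its Corollary (`B(x, y) = (Ax, y)`)]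
[cite: HornJohnson2013, §0.6.5 (orthonormal bases)] -/
theorem exists_isSymmetric_inner_eq (B : E →ₗ[ℝ] E →ₗ[ℝ] ℝ) (hB : ∀ u v, B u v = B v u) :
    ∃ A : E →ₗ[ℝ] E, A.IsSymmetric ∧ ∀ u v, ⟪A u, v⟫_ℝ = B u v := by
  classical
  set b := stdOrthonormalBasis ℝ E with hb
  set A : E →ₗ[ℝ] E := ∑ i, (LinearMap.toSpanSingleton ℝ E (b i)) ∘ₗ (B.flip (b i)) with hA
  have hAu : ∀ u, A u = ∑ i, B u (b i) • b i := fun u => by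
    simp only [hA, LinearMap.sum_apply, LinearMap.comp_apply, LinearMap.flip_apply,
      LinearMap.toSpanSingleton_apply]
  have hinner : ∀ u v, ⟪A u, v⟫_ℝ = B u v := by
    intro u v
    rw [hAu, sum_inner]
    conv_rhs => rw [← b.sum_repr' v]
    rw [map_sum]
    refine Finset.sum_congr rfl fun i _ => ?_
    rw [real_inner_smul_left, map_smul, smul_eq_mul, mul_comm]
  exact ⟨A, fun u v => by rw [hinner, hB, ← hinner, real_inner_comm], hinner⟩

/-- Coercivity transfer: if `c‖u‖² ≤ B(u, u)` then the representing operator satisfies `c‖u‖² ≤ ⟪A u, u⟫`, and if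
`B(u, u) > 0` for `u ≠ 0` then `⟪A u, u⟫ > 0` — the hypotheses `hcoer` ∕ `hpos` of the Laplace-method theorems, from a
Hessian given as a FORM. [cite: ReedSimon1972, vol. I §II.2 Thm II.4 and Corollary] -/
theorem exists_isSymmetric_inner_eq_of_coercive (B : E →ₗ[ℝ] E →ₗ[ℝ] ℝ) (hB : ∀ u v, B u v = B v u) {c : ℝ}
    (hcoer : ∀ u, c * ‖u‖ ^ 2 ≤ B u u) :
    ∃ A : E →ₗ[ℝ] E, A.IsSymmetric ∧ (∀ u v, ⟪A u, v⟫_ℝ = B u v) ∧ ∀ u, c * ‖u‖ ^ 2 ≤ ⟪A u, u⟫_ℝ := by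
  obtain ⟨A, hA, h⟩ := exists_isSymmetric_inner_eq B hB
  exact ⟨A, hA, h, fun u => by rw [h]; exact hcoer u⟩

omit [FiniteDimensional ℝ E] in
/-- Positivity transfer: `B(u, u) > 0` for `u ≠ 0` and `⟪A u, v⟫ = B(u, v)` ⇒ `⟪A u, u⟫ > 0` for `u ≠ 0`.
[cite: HornJohnson2013, Thm 7.2.7 ∕ Cor. 7.2.8] -/
theorem inner_pos_of_form_pos {B : E →ₗ[ℝ] E →ₗ[ℝ] ℝ} {A : E →ₗ[ℝ] E} (h : ∀ u v, ⟪A u, v⟫_ℝ = B u v)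
    (hpos : ∀ u, u ≠ 0 → 0 < B u u) (u : E) (hu : u ≠ 0) : 0 < ⟪A u, u⟫_ℝ := by
  rw [h]
  exact hpos u hu

end Operator

/-! ## §3 Gram operators `T†T` identified through their forms -/

section Gram

variable {E F : Type*} [NormedAddCommGroup E] [InnerProductSpace ℝ E] [FiniteDimensional ℝ E]
  [NormedAddCommGroup F] [InnerProductSpace ℝ F] [FiniteDimensional ℝ F]

/-- **`T†T` is determined by the form `⟪T x, T y⟫`.**  If `⟪T x, T y⟫ = ⟪G x, y⟫` for all `x, y`, then
`T† ∘ T = G`. [cite: HornJohnson2013, Thm 7.2.10 (Gram matrices) with Thm 7.2.7 (`A = B^*B`)] -/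
theorem adjoint_comp_self_eq_of_inner (T : E →ₗ[ℝ] F) (G : E →ₗ[ℝ] E)
    (h : ∀ x y, ⟪T x, T y⟫_ℝ = ⟪G x, y⟫_ℝ) : LinearMap.adjoint T ∘ₗ T = G := by
  refine LinearMap.ext fun x => ext_inner_right ℝ fun y => ?_
  rw [LinearMap.comp_apply, LinearMap.adjoint_inner_left, h]

/-- **The Gram ∕ Faddeev–Popov determinant in the consumer's own currency.**  If the form of `T : E → F` is a
conjugate of an operator `Δ` on another space `P` through a linear isomorphism `e : P ≃ₗ E`,
`⟪T x, T y⟫ = ⟪e (Δ (e⁻¹ x)), y⟫`, then `det(T† ∘ T) = det Δ`.  (Typical use: `E, F` Euclidean models of §1 for two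
spaces with `L²`-type forms, `T` the model of a «gradient» `D`, `Δ = D^{*}D` its Laplacian computed with the original
forms: `b_F(D p, D q) = b_P(Δ p, q)`.)
[cite: HornJohnson2013, Thm 7.2.10 and Thm 7.2.7 (Gram matrices `B^*B`); §1.3 (similarity invariance of the determinant)] -/
theorem det_adjoint_comp_self_eq_det_of_inner_conj {P : Type*} [AddCommGroup P] [Module ℝ P] (T : E →ₗ[ℝ] F)
    (e : P ≃ₗ[ℝ] E) (Δ : P →ₗ[ℝ] P) (h : ∀ x y, ⟪T x, T y⟫_ℝ = ⟪e (Δ (e.symm x)), y⟫_ℝ) :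
    LinearMap.det (LinearMap.adjoint T ∘ₗ T) = LinearMap.det Δ := by
  have hG := adjoint_comp_self_eq_of_inner T ((e : P →ₗ[ℝ] E) ∘ₗ Δ ∘ₗ (e.symm : E →ₗ[ℝ] P)) fun x y => by
    rw [h]; rfl
  rw [hG, LinearMap.det_conj]

end Gram

end Literature.Analysis.InnerProduct
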